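import Summits.QuantumFields.YangMills.Theorems.ColdStartUniversalityLatticeLangevinBakryEmeryLogSobolev
import Summits.QuantumFields.YangMills.Theorems.ColdStartUniversalityLatticeLangevinWilsonEntropyDecayLaw
import Summits.QuantumFields.YangMills.Theorems.ColdStartUniversalityUniformColdStartMixingPinskerStep
import HarnessLib

/-!
# Route `ColdStartUniversality` (fixed-cut-off package, Bakry–Émery side): VOLUME-UNIFORM DECAY OF THE RELATIVE ENTROPY
# `KL(law(U_t) ‖ μ_(β'))` along EVERY solution of the SZZ dynamics at `|β'| < 1/12`, and cold-start mixing of bounded observables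

Helper file (seat `ym-line-csu-p1`, g26; `--supports stmt-QuantumFields-24809`).  Consequences of the volume-uniform log-Sobolev inequality
`wilson_generatorLogSobolev_uniform` (constant `(1 − 12|β'|)/2`) for the SU(2) lattice Langevin dynamics of Shen–Zhu–Zhu on `(ℤ/L)³` at a
FIXED cut-off, through g21's `klDiv_map_le_exp_of_generatorLogSobolev` (BGL Thm 5.2.1 in Mathlib's `klDiv` currency) and the tree's Pinsker
inequality `abs_integral_sub_integral_le_sqrt_two_mul_klDiv`:
* ★★★ `wilson_klDiv_map_le_exp_uniform` — for every `L`, `|β'| < 1/12`, every solution `U` from a deterministic start on ANY probability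
  space, every lattice time `τ₀ > 0` and every `u ≥ 0`:
    `KL(law(U_(τ₀+u)) ‖ μ_(β')) ≤ e^(−2(1−12|β'|)u) · KL(law(U_(τ₀)) ‖ μ_(β'))`  — rate independent of `L`;
* ★ `wilson_klDiv_map_ne_top` — in particular `KL(law(U_(τ₀)) ‖ μ_(β')) < ∞` for `τ₀ > 0`;
* ★★ `wilson_coldStart_observable_le_exp_uniform` — for every measurable `|g| ≤ 1`:
    `|E g(U_(τ₀+u)) − ∫ g dμ_(β')| ≤ e^(−(1−12|β'|)u) · √(2·KL(law(U_(τ₀)) ‖ μ_(β')))`,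
  i.e. bounded observables relax to the Wilson–Gibbs mean at the VOLUME-UNIFORM rate `1 − 12|β'|` from every start, with an entropy
  (not `χ²`) burn-in constant (compare g25's `coldStart_measurable_sq_sub_le_exp_uniform`: same rate, `L²` burn-in).
HONEST FRAMING: FIXED cut-off, fixed `|β'| < 1/12`, lattice time; the burn-in `KL(law(U_(τ₀)) ‖ μ)` depends on `L` (and is only known to be
finite here); the route's scaling `β'_K → ∞` leaves the window — nothing is K-uniform in the sense of 24809 (ASIDE, not restated); no crux,
rung or summit statement is proved; the Yang–Mills mass gap is NOT proved.  THEOREMS ONLY, no definition, no sorry.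
-/

set_option autoImplicit false

noncomputable section

namespace Summit.QuantumFields.YangMills.Theorems.ColdStartUniversality

open MeasureTheory ProbabilityTheory Finset Filter Set InformationTheory
open scoped BigOperators NNReal ENNReal Topology
open Literature.Probability.Process Literature.MathematicalPhysics.QuantumFieldTheory
open Literature.MathematicalPhysics.QuantumLattice (fundamentalRep fundamentalLatticeRep continuous_fundamentalRep)

variable {L : ℕ} [NeZero L]

/-- ★★★ **Volume-uniform exponential decay of `KL(law(U_t) ‖ μ_(β'))` at `|β'| < 1/12`.**  For every torus size `L`, every solution `U` of the
SU(2) SZZ dynamics from a deterministic start on any probability space, every lattice time `τ₀ > 0` and every `u ≥ 0`: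
`KL(law(U_(τ₀+u)) ‖ μ_(β')) ≤ e^(−2(1−12|β'|)u) · KL(law(U_(τ₀)) ‖ μ_(β'))`. [cite: ShenZhuZhu2022, §4 Theorem 4.2] -/
theorem wilson_klDiv_map_le_exp_uniform (L : ℕ) [NeZero L] (β' : ℝ) (hβ : |β'| < 1 / 12)
    {Ω : Type} [MeasurableSpace Ω] {P : Measure Ω} [IsProbabilityMeasure P]
    {W : ℝ≥0 → Ω → (Edge 3 L × NoiseIdx 2 → ℝ)} (hW : IsFlatBrownian W P)
    {U : ℝ≥0 → Ω → GaugeConfig 3 L (Matrix.specialUnitaryGroup (Fin 2) ℂ)}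
    (z : GaugeConfig 3 L (Matrix.specialUnitaryGroup (Fin 2) ℂ)) (hU0 : ∀ ω, U 0 ω = z)
    (hU : (latticeLangevinDynamics (fundamentalLatticeRep 2) β').IsSolution (fundamentalRep (Fin 2)) hW.natFiltration P W U)
    {τ₀ : ℝ≥0} (hτ₀ : 0 < (τ₀ : ℝ)) (u : ℝ≥0) :
    klDiv (P.map (U (τ₀ + u))) (wilsonMeasure (d := 3) (L := L) (fundamentalRep (Fin 2)) β') ≤
      ENNReal.ofReal (Real.exp (-(2 * (1 - 12 * |β'|)) * u) * (klDiv (P.map (U τ₀)) (wilsonMeasure (d := 3) (L := L) (fundamentalRep (Fin 2)) β')).toReal) := by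
  have hρ : 0 < (1 - 12 * |β'|) / 2 := by linarith
  have h := klDiv_map_le_exp_of_generatorLogSobolev L β' hρ
    (fun f hf => wilson_generatorLogSobolev_uniform L β' hβ f hf) hW z hU0 hU hτ₀ u
  have e : Real.exp (-4 * ((1 - 12 * |β'|) / 2) * (u : ℝ)) = Real.exp (-(2 * (1 - 12 * |β'|)) * (u : ℝ)) := by
    congr 1; ring
  rw [e] at h
  exact h

/-- ★ **`KL(law(U_(τ₀)) ‖ μ_(β')) < ∞` for `τ₀ > 0`** (at `|β'| < 1/12`; read off the decay inequality at `u = 0`). [folklore] -/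
theorem wilson_klDiv_map_ne_top (L : ℕ) [NeZero L] (β' : ℝ) (hβ : |β'| < 1 / 12)
    {Ω : Type} [MeasurableSpace Ω] {P : Measure Ω} [IsProbabilityMeasure P]
    {W : ℝ≥0 → Ω → (Edge 3 L × NoiseIdx 2 → ℝ)} (hW : IsFlatBrownian W P)
    {U : ℝ≥0 → Ω → GaugeConfig 3 L (Matrix.specialUnitaryGroup (Fin 2) ℂ)}
    (z : GaugeConfig 3 L (Matrix.specialUnitaryGroup (Fin 2) ℂ)) (hU0 : ∀ ω, U 0 ω = z)
    (hU : (latticeLangevinDynamics (fundamentalLatticeRep 2) β').IsSolution (fundamentalRep (Fin 2)) hW.natFiltration P W U)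
    {τ₀ : ℝ≥0} (hτ₀ : 0 < (τ₀ : ℝ)) :
    klDiv (P.map (U τ₀)) (wilsonMeasure (d := 3) (L := L) (fundamentalRep (Fin 2)) β') ≠ ∞ := by
  have h := wilson_klDiv_map_le_exp_uniform L β' hβ hW z hU0 hU hτ₀ 0
  rw [add_zero] at h
  exact ne_top_of_le_ne_top ENNReal.ofReal_ne_top h

/-- ★★ **Cold-start mixing of bounded observables at the volume-uniform rate `1 − 12|β'|`.**  For every `L`, `|β'| < 1/12`, every solution
`U` from a deterministic start, `τ₀ > 0`, `u ≥ 0` and every measurable observable `|g| ≤ 1` on `SU(2)^E`: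
`|E g(U_(τ₀+u)) − ∫ g dμ_(β')| ≤ e^(−(1−12|β'|)u) · √(2·KL(law(U_(τ₀)) ‖ μ_(β')))` (Pinsker + `wilson_klDiv_map_le_exp_uniform`).
[cite: ShenZhuZhu2022, §4 Theorem 4.2] -/
theorem wilson_coldStart_observable_le_exp_uniform (L : ℕ) [NeZero L] (β' : ℝ) (hβ : |β'| < 1 / 12)
    {Ω : Type} [MeasurableSpace Ω] {P : Measure Ω} [IsProbabilityMeasure P]
    {W : ℝ≥0 → Ω → (Edge 3 L × NoiseIdx 2 → ℝ)} (hW : IsFlatBrownian W P)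
    {U : ℝ≥0 → Ω → GaugeConfig 3 L (Matrix.specialUnitaryGroup (Fin 2) ℂ)}
    (z : GaugeConfig 3 L (Matrix.specialUnitaryGroup (Fin 2) ℂ)) (hU0 : ∀ ω, U 0 ω = z)
    (hU : (latticeLangevinDynamics (fundamentalLatticeRep 2) β').IsSolution (fundamentalRep (Fin 2)) hW.natFiltration P W U)
    {τ₀ : ℝ≥0} (hτ₀ : 0 < (τ₀ : ℝ)) (u : ℝ≥0)
    {g : (GaugeConfig 3 L (Matrix.specialUnitaryGroup (Fin 2) ℂ)) → ℝ} (hgm : Measurable g) (hgb : ∀ x, |g x| ≤ 1) :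
    |(∫ ω, g (U (τ₀ + u) ω) ∂P) - ∫ x, g x ∂(wilsonMeasure (d := 3) (L := L) (fundamentalRep (Fin 2)) β')| ≤
      Real.exp (-(1 - 12 * |β'|) * u) * Real.sqrt (2 * (klDiv (P.map (U τ₀)) (wilsonMeasure (d := 3) (L := L) (fundamentalRep (Fin 2)) β')).toReal) := by
  classical
  haveI := secondCountableTopology_su2
  haveI := borelSpace_config L
  haveI : IsProbabilityMeasure (wilsonMeasure (d := 3) (L := L) (fundamentalRep (Fin 2)) β') :=
    isProbabilityMeasure_wilsonMeasure (d := 3) (L := L) (fundamentalRep (Fin 2)) (continuous_fundamentalRep (Fin 2)) β'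
  have hmU : ∀ t : ℝ≥0, Measurable (U t) := fun t => (hU.adapted t).mono (hW.natFiltration.le t) le_rfl
  haveI : IsProbabilityMeasure (P.map (U (τ₀ + u))) := Measure.isProbabilityMeasure_map (hmU _).aemeasurable
  have hdec := wilson_klDiv_map_le_exp_uniform L β' hβ hW z hU0 hU hτ₀ u
  have hfin : klDiv (P.map (U (τ₀ + u))) (wilsonMeasure (d := 3) (L := L) (fundamentalRep (Fin 2)) β') ≠ ∞ := ne_top_of_le_ne_top ENNReal.ofReal_ne_top hdec
  have hP := abs_integral_sub_integral_le_sqrt_two_mul_klDiv hfin hgm hgb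
  rw [integral_map (hmU _).aemeasurable hgm.aestronglyMeasurable] at hP
  refine hP.trans ?_
  -- `√(2·KL_(τ₀+u)) ≤ e^(−cu) √(2·KL_(τ₀))`
  have hK0 : 0 ≤ (klDiv (P.map (U τ₀)) (wilsonMeasure (d := 3) (L := L) (fundamentalRep (Fin 2)) β')).toReal := ENNReal.toReal_nonneg
  have hle : (klDiv (P.map (U (τ₀ + u))) (wilsonMeasure (d := 3) (L := L) (fundamentalRep (Fin 2)) β')).toReal ≤
      Real.exp (-(2 * (1 - 12 * |β'|)) * u) * (klDiv (P.map (U τ₀)) (wilsonMeasure (d := 3) (L := L) (fundamentalRep (Fin 2)) β')).toReal := by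
    have h := ENNReal.toReal_mono ENNReal.ofReal_ne_top hdec
    rwa [ENNReal.toReal_ofReal (mul_nonneg (Real.exp_pos _).le hK0)] at h
  have hsq : Real.sqrt (2 * (klDiv (P.map (U (τ₀ + u))) (wilsonMeasure (d := 3) (L := L) (fundamentalRep (Fin 2)) β')).toReal) ≤
      Real.sqrt (2 * (Real.exp (-(2 * (1 - 12 * |β'|)) * u) * (klDiv (P.map (U τ₀)) (wilsonMeasure (d := 3) (L := L) (fundamentalRep (Fin 2)) β')).toReal)) :=
    Real.sqrt_le_sqrt (by linarith)
  refine hsq.trans (le_of_eq ?_)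
  have hexp : Real.exp (-(2 * (1 - 12 * |β'|)) * (u : ℝ)) = Real.exp (-(1 - 12 * |β'|) * u) * Real.exp (-(1 - 12 * |β'|) * u) := by
    rw [← Real.exp_add]; congr 1; ring
  rw [hexp, show 2 * (Real.exp (-(1 - 12 * |β'|) * (u : ℝ)) * Real.exp (-(1 - 12 * |β'|) * u) *
      (klDiv (P.map (U τ₀)) (wilsonMeasure (d := 3) (L := L) (fundamentalRep (Fin 2)) β')).toReal) =
      (Real.exp (-(1 - 12 * |β'|) * u)) ^ 2 * (2 * (klDiv (P.map (U τ₀)) (wilsonMeasure (d := 3) (L := L) (fundamentalRep (Fin 2)) β')).toReal) by ring,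
    Real.sqrt_mul' _ (mul_nonneg (by norm_num) hK0), Real.sqrt_sq (Real.exp_pos _).le]

end Summit.QuantumFields.YangMills.Theorems.ColdStartUniversality
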